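import Mathlib
import Summits.Ventures.PercRepro.RankLevelSetTriangleStar
import Summits.Ventures.PercRepro.TriangleCapMatroidReduction
import Summits.Ventures.PercRepro.TriangleCapDeltaForm
import Summits.Ventures.PercRepro.TriangleCapSplitReduction

/-!
# PercRepro — the Δ-form hypothesis is only needed on triangle-covered, triangle-inseparable matroids (p3, gen 26)

A point on no triangle can be deleted: `T(M) = T(M ↾ (E ∖ {x}))` and the nullity does not increase
(`r(E ∖ {x}) + 1 ≥ r(E)`).  So the Δ-cocircuit of `TriangleCapSplitReduction` is needed only in the
**core class**: finite `Core3` matroids with a triangle, without a triangle split, in which EVERY point lies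
on a triangle.  This file records that reduction in the kernel.

* `TriangleCovered M` — every point of `M.E` lies on a triangle;
* `ExistsDeltaCocircuitCore α` — the Δ-form existence on the core class only;
* `existsDeltaCocircuitCore_of_existsDeltaCocircuitInsep` — implied by the inseparable form;
* `ncard_triangles_eq_of_not_covered` — deleting a point on no triangle keeps the triangles;
* `eRank_le_eRk_diff_singleton_add_one` — `r(E) ≤ r(E ∖ {x}) + 1`;
* **`ncard_triangles_le_P_of_existsDeltaCocircuitCore`** — `ExistsDeltaCocircuitCore α → T(M) ≤ P_KK ν`.
The closed-form theorem is CONDITIONAL on its named hypothesis by construction. Axioms: standard.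
-/

open scoped Matroid

namespace PercRepro

namespace TriangleCap

namespace Cocirc

open Set

variable {α : Type}

/-- Every point of the ground set lies on a triangle. -/
def TriangleCovered (M : Matroid α) : Prop :=
  ∀ x ∈ M.E, ∃ C ∈ ThmN.triangles M, x ∈ C

/-- The Δ-form existence hypothesis on the **core class** only: finite `Core3` matroids with a triangle, without
a triangle split, in which every point lies on a triangle. -/
def ExistsDeltaCocircuitCore (α : Type) : Prop :=
  ∀ (M : Matroid α) [M.Finite], Core3 M → (ThmN.triangles M).Nonempty → ¬ HasTriangleSplit M →
    TriangleCovered M → ∀ ν : ℕ, M.E.encard = M.eRank + ν →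
      ∃ K : Set α, M.IsCocircuit K ∧ gain M K ≤ KK.P ν - KK.P (ν - (K.ncard - 1))

/-- The inseparable form implies the core form. -/
theorem existsDeltaCocircuitCore_of_existsDeltaCocircuitInsep (h : ExistsDeltaCocircuitInsep α) :
    ExistsDeltaCocircuitCore α :=
  fun M _ hM hT hsp _ ν hν => h M hM hT hsp ν hν

/-- Deleting a point on no triangle keeps every triangle. -/
theorem ncard_triangles_eq_of_not_covered (M : Matroid α) [M.Finite] {x : α} (hx : x ∈ M.E)
    (hno : ∀ C ∈ ThmN.triangles M, x ∉ C) :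
    (ThmN.triangles (M ↾ (M.E \ {x}))).ncard = (ThmN.triangles M).ncard := by
  rw [triangles_restrict M sdiff_subset]
  congr 1
  ext C
  constructor
  · rintro ⟨hC, -⟩
    exact hC
  · intro hC
    refine ⟨hC, ?_⟩
    intro y hy
    refine ⟨hC.1.subset_ground hy, ?_⟩
    rintro rfl
    exact hno C hC hy

/-- `r(E) ≤ r(E ∖ {x}) + 1`. -/
theorem eRank_le_eRk_diff_singleton_add_one (M : Matroid α) {x : α} (hx : x ∈ M.E) :
    M.eRank ≤ M.eRk (M.E \ {x}) + 1 := by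
  have h := M.eRk_insert_le_add_one x (M.E \ {x})
  rwa [insert_sdiff_singleton, insert_eq_of_mem hx, M.eRk_ground] at h

/-- **The reduction to the core class.** If every finite triangle-covered, triangle-inseparable matroid of the
class with a triangle has a cocircuit `K` with `gain M K ≤ P ν − P (ν − (|K| − 1))`, then every finite matroid
of the class with `|E| = r(E) + ν` has at most `P_KK ν` triangles. -/
theorem ncard_triangles_le_P_of_existsDeltaCocircuitCore (hGB : ExistsDeltaCocircuitCore α)
    (M : Matroid α) [M.Finite] (hM : Core3 M) {ν : ℕ} (hν : M.E.encard = M.eRank + ν) :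
    (ThmN.triangles M).ncard ≤ KK.P ν := by
  suffices H : ∀ n : ℕ, ∀ (M : Matroid α) [M.Finite], M.E.ncard = n → Core3 M →
      ∀ ν : ℕ, M.E.encard = M.eRank + ν → (ThmN.triangles M).ncard ≤ KK.P ν from
    H _ M rfl hM ν hν
  intro n
  induction n using Nat.strong_induction_on with
  | _ n ih =>
  intro M _ hn hM ν hν
  by_cases hT : (ThmN.triangles M).Nonempty
  swap
  · rw [Set.not_nonempty_iff_eq_empty] at hT
    rw [hT, ncard_empty]
    exact Nat.zero_le _
  have hEfin := M.ground_finite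
  have hRne : M.eRank ≠ ⊤ := ((M.eRank_le_encard_ground).trans_lt hEfin.encard_lt_top).ne
  obtain ⟨r, hr⟩ := ENat.ne_top_iff_exists.1 hRne
  by_cases hcov : TriangleCovered M
  swap
  · -- a point on no triangle: delete it
    simp only [TriangleCovered, not_forall] at hcov
    obtain ⟨x, hx, hno⟩ := hcov
    have hno' : ∀ C ∈ ThmN.triangles M, x ∉ C := by
      intro C hC hxC
      exact hno ⟨C, hC, hxC⟩
    have hD : M.E \ {x} ⊆ M.E := sdiff_subset
    have hDfin : (M.E \ {x}).Finite := hEfin.subset hD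
    haveI : (M ↾ (M.E \ {x})).Finite := Matroid.restrict_finite hDfin
    have hrDne : M.eRk (M.E \ {x}) ≠ ⊤ := ((M.eRk_le_encard _).trans_lt hDfin.encard_lt_top).ne
    obtain ⟨rD, hrD⟩ := ENat.ne_top_iff_exists.1 hrDne
    have hrDle : M.eRk (M.E \ {x}) ≤ (M.E \ {x}).encard := M.eRk_le_encard _
    rw [← hrD, ← hDfin.cast_ncard_eq] at hrDle
    have hrDle' : rD ≤ (M.E \ {x}).ncard := by exact_mod_cast hrDle
    have hrank := eRank_le_eRk_diff_singleton_add_one M hx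
    rw [← hr, ← hrD] at hrank
    have hrank' : r ≤ rD + 1 := by exact_mod_cast hrank
    rw [← hr, ← hEfin.cast_ncard_eq] at hν
    have hE : M.E.ncard = r + ν := by exact_mod_cast hν
    have hcard : (M.E \ {x}).ncard + 1 = M.E.ncard := ncard_sdiff_singleton_add_one hx hEfin
    obtain ⟨νD, hνD⟩ : ∃ νD : ℕ, (M.E \ {x}).ncard = rD + νD := ⟨(M.E \ {x}).ncard - rD, by omega⟩
    have hνD' : (M ↾ (M.E \ {x})).E.encard = (M ↾ (M.E \ {x})).eRank + (νD : ℕ∞) := by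
      rw [Matroid.restrict_ground_eq, Matroid.eRank_restrict, ← hrD, ← hDfin.cast_ncard_eq, hνD]
      push_cast
      rfl
    have hlt : (M.E \ {x}).ncard < n := by
      rw [← hn]
      exact ncard_sdiff_singleton_lt_of_mem hx hEfin
    have ih' := ih _ hlt (M ↾ (M.E \ {x})) rfl (hM.restrict hD) _ hνD'
    rw [ncard_triangles_eq_of_not_covered M hx hno'] at ih'
    have hle : νD ≤ ν := by omega
    exact ih'.trans (KK.P_mono hle)
  by_cases hsp : HasTriangleSplit M
  · obtain ⟨A, B, hAB, hdisj, ⟨CA, hCA, hCAA⟩, ⟨CB, hCB, hCBB⟩, hsplit⟩ := hsp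
    have hA : A ⊆ M.E := hAB ▸ subset_union_left
    have hB : B ⊆ M.E := hAB ▸ subset_union_right
    have hAfin : A.Finite := hEfin.subset hA
    have hBfin : B.Finite := hEfin.subset hB
    haveI : (M ↾ A).Finite := Matroid.restrict_finite hAfin
    haveI : (M ↾ B).Finite := Matroid.restrict_finite hBfin
    have hrAne : M.eRk A ≠ ⊤ := ((M.eRk_le_encard _).trans_lt hAfin.encard_lt_top).ne
    obtain ⟨rA, hrA⟩ := ENat.ne_top_iff_exists.1 hrAne
    have hrBne : M.eRk B ≠ ⊤ := ((M.eRk_le_encard _).trans_lt hBfin.encard_lt_top).ne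
    obtain ⟨rB, hrB⟩ := ENat.ne_top_iff_exists.1 hrBne
    have hrAle : M.eRk A ≤ A.encard := M.eRk_le_encard _
    rw [← hrA, ← hAfin.cast_ncard_eq] at hrAle
    have hrAle' : rA ≤ A.ncard := by exact_mod_cast hrAle
    have hrBle : M.eRk B ≤ B.encard := M.eRk_le_encard _
    rw [← hrB, ← hBfin.cast_ncard_eq] at hrBle
    have hrBle' : rB ≤ B.ncard := by exact_mod_cast hrBle
    obtain ⟨νA, hνA⟩ : ∃ νA : ℕ, A.ncard = rA + νA := ⟨A.ncard - rA, by omega⟩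
    obtain ⟨νB, hνB⟩ : ∃ νB : ℕ, B.ncard = rB + νB := ⟨B.ncard - rB, by omega⟩
    have hνA' : (M ↾ A).E.encard = (M ↾ A).eRank + (νA : ℕ∞) := by
      rw [Matroid.restrict_ground_eq, Matroid.eRank_restrict, ← hrA, ← hAfin.cast_ncard_eq, hνA]
      push_cast
      rfl
    have hνB' : (M ↾ B).E.encard = (M ↾ B).eRank + (νB : ℕ∞) := by
      rw [Matroid.restrict_ground_eq, Matroid.eRank_restrict, ← hrB, ← hBfin.cast_ncard_eq, hνB]
      push_cast
      rfl
    have hAne : A.Nonempty := hCA.1.nonempty.mono hCAA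
    have hBne : B.Nonempty := hCB.1.nonempty.mono hCBB
    have hAss : A ⊂ M.E := by
      refine hA.ssubset_of_ne ?_
      intro hAE
      obtain ⟨x, hxB⟩ := hBne
      have hxA : x ∈ A := hAE ▸ hB hxB
      exact (Set.disjoint_left.1 hdisj) hxA hxB
    have hBss : B ⊂ M.E := by
      refine hB.ssubset_of_ne ?_
      intro hBE
      obtain ⟨x, hxA⟩ := hAne
      have hxB : x ∈ B := hBE ▸ hA hxA
      exact (Set.disjoint_left.1 hdisj) hxA hxB
    have hltA : A.ncard < n := by
      rw [← hn]
      exact ncard_lt_ncard hAss hEfin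
    have hltB : B.ncard < n := by
      rw [← hn]
      exact ncard_lt_ncard hBss hEfin
    have ihA := ih _ hltA (M ↾ A) rfl (hM.restrict hA) _ hνA'
    have ihB := ih _ hltB (M ↾ B) rfl (hM.restrict hB) _ hνB'
    rw [← hr, ← hEfin.cast_ncard_eq] at hν
    have hE : M.E.ncard = r + ν := by exact_mod_cast hν
    have hsum := nullity_add_le_of_union M hAB hdisj hrA.symm hrB.symm hr.symm hνA hνB hE
    have h1 := KK.P_superadd νA νB
    have h2 := KK.P_mono hsum
    rw [ncard_triangles_eq_add_of_split M hAB hdisj hsplit]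
    omega
  obtain ⟨K, hK, hg⟩ := hGB M hM hT hsp hcov ν hν
  have hHE : M.E \ K ⊆ M.E := sdiff_subset
  have hKE : K ⊆ M.E := hK.subset_ground
  have hHfin : (M.E \ K).Finite := hEfin.subset hHE
  have hKfin : K.Finite := hEfin.subset hKE
  haveI : (M ↾ (M.E \ K)).Finite := Matroid.restrict_finite hHfin
  have hrk := eRk_compl_add_one_eq_eRank M hK
  have hrne : M.eRk (M.E \ K) ≠ ⊤ := ((M.eRk_le_encard _).trans_lt hHfin.encard_lt_top).ne
  obtain ⟨rH, hrH⟩ := ENat.ne_top_iff_exists.1 hrne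
  have hEcard : M.E.encard = (M.E \ K).encard + K.encard := by
    rw [← encard_union_eq disjoint_sdiff_left, sdiff_union_of_subset hKE]
  have hrHle : M.eRk (M.E \ K) ≤ (M.E \ K).encard := M.eRk_le_encard _
  rw [← hr, ← hrH] at hrk
  rw [← hr, hEcard, ← hHfin.cast_ncard_eq, ← hKfin.cast_ncard_eq] at hν
  rw [← hrH, ← hHfin.cast_ncard_eq] at hrHle
  have hrk' : rH + 1 = r := by exact_mod_cast hrk
  have hν' : (M.E \ K).ncard + K.ncard = r + ν := by exact_mod_cast hν
  have hrHle' : rH ≤ (M.E \ K).ncard := by exact_mod_cast hrHle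
  have hd1 : 1 ≤ K.ncard := (ncard_pos hKfin).2 hK.nonempty
  have hν2 : (M ↾ (M.E \ K)).E.encard = (M ↾ (M.E \ K)).eRank + ((ν - (K.ncard - 1) : ℕ) : ℕ∞) := by
    rw [Matroid.restrict_ground_eq, Matroid.eRank_restrict, ← hrH, ← hHfin.cast_ncard_eq]
    have : (M.E \ K).ncard = rH + (ν - (K.ncard - 1)) := by omega
    rw [this]
    push_cast
    rfl
  have hlt : (M.E \ K).ncard < n := by
    rw [← hn]
    exact ncard_lt_ncard (hKE.sdiff_ssubset_of_nonempty hK.nonempty) hEfin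
  have ih' := ih _ hlt (M ↾ (M.E \ K)) rfl (hM.restrict hHE) _ hν2
  rw [ncard_triangles_eq_restrict_add_gain M K]
  have hmono : KK.P (ν - (K.ncard - 1)) ≤ KK.P ν := KK.P_mono (Nat.sub_le _ _)
  omega

end Cocirc

end TriangleCap

end PercRepro
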